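/-
Copyright (c) 2026 the pub-hodgecm-mathlib formalisation cell (harness21).  Prover seat hodgecm-mathlib-K2E1b-p07 (g0), Track B ∕ K2-LIT
(build stream 29), h413 = `stmt-HodgeConjecture-24833`, line `K2_E1b_GKCohomologyU21`, socket module U0 «TwistIntegration», file #9 — the payment of
`K2E1bGKCohomologyU21.U0.sig_K2E1bTwistIrreducible` TOKEN FOR TOKEN.  2026-09-03.
-/
import Literature.RepresentationTheory.BorelWallach2000.UpqComplexSpan          -- ★ K0: `upq_isIrreducibleGK_of_forall_submodule`
import Literature.RepresentationTheory.Kovacevic2021.SU21ModulesFromKTypes      -- ★ `SU21Datum`, `SU21Datum.ρ`, `lie_def`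
import Summits.HodgeConjecture.HodgeConjecture.Theorems.F0P3bU21Restriction     -- ★ `G21`, `kovLie`, `kovLie_apply`
import Summits.HodgeConjecture.HodgeConjecture.Theorems.K2E1bKTypeTwistDefs    -- ★ defs leaf: `IsTwistOf` (p854741)
import HarnessLib

/-!
# h413 ∕ Track B «K2-LIT», line `K2_E1b_GKCohomologyU21`, unit U0 «TWIST INTEGRATION», file #9: IRREDUCIBILITY SURVIVES THE CENTRAL TWIST
# (payment of `Cruxes/H413/Lines/K2_E1b_GKCohomologyU21_U0_TwistIntegration.lean :: sig_K2E1bTwistIrreducible`, statement bytes frozen)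

Cell `pub/hodgecm-mathlib`, crux H413 = `stmt-HodgeConjecture-24833`, route of record `HCCMUnconditional`; chair K2-lead (g0), dealer K2E1b-plan (g0),
EMIT «SKELETON LANDED K2E1b» (REQUESTS l.72387) file #9 `sig_K2E1bTwistIrreducible` (M) ↦ seat K2E1b-p07.
THEOREMS ONLY (no `def`, no `instance`, no `notation`, no named-fact hypothesis, no `sorry`); imports = ★ K0 `BorelWallach2000/UpqComplexSpan`,
★ `Kovacevic2021/SU21ModulesFromKTypes`, ★ `Theorems/F0P3bU21Restriction` (`G21`, `kovLie`), ★ defs leaf `Theorems/K2E1bKTypeTwistDefs` (`IsTwistOf`,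
p854741) + HarnessLib; lane `--supports stmt-HodgeConjecture-24833 --as helper` (count-neutral: one U0 brick of the line, it does not move 24833).

THE STATEMENT (bytes of the socket).  For every Kovačević datum `𝒟 : SU21Datum`, every `e : ℤ` and every real Lie algebra action
`σ : 𝔲(2,1) → End_ℂ 𝒟.V` which is the central twist of `𝒟.ρ` by `e∕3` (`IsTwistOf 𝒟.ρ (e∕3) σ`: `σ X = kovLie 𝒟.ρ X + (e∕3)·tr(X)·1`), if `𝒟.V` is an
irreducible `𝔤𝔩(3, ℂ)`-module then `(ρK, σ)` is an irreducible `(𝔤, K)`-module (`IsIrreducibleGK`) for every `K`-action `ρK` with `IsGKModule G21 ρK σ`.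

WHY THE LINE WANTS IT (U0 module docstring «WHY THIS UNIT»; [Rogawski1990 §12.3 pp. 176–178]).  Rogawski's archimedean table needs the cohomological
modules `J^±_φ`, `D_φ`, `π²_φ` for EVERY `φ = (a, b, c)`, whose centre acts by `i·e(φ)`, `e = a + b + c`; Kovačević's kernel-checked `𝔤𝔩(3, ℂ)`-data have
the centre acting by `0`, and U0 supplies the central twist.  This file is the irreducibility clause of the per-datum package `sig_K2E1bDatumCohUnitaryIrrep`.

THE PROOF (strategy: ★ K0's complex-span transport, run for an action that is a Lie-module action PLUS A SCALAR COCYCLE).  §1 proves, for arbitrary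
finite index types `α, β`, a complex Lie algebra `L` with `V` an irreducible Lie module, a surjective complex-linear `e : 𝔤𝔩(α ⊕ β, ℂ) → L` and ANY
complex-linear functional `c` on `𝔤𝔩(α ⊕ β, ℂ)`: if `ρ𝔤 X v = ⁅e X, v⁆ + c(X) • v` on `𝔲(α, β)` then `IsIrreducibleGK ρK ρ𝔤` for every `ρK`.  Indeed a
`(𝔤, K)`-submodule `W` is stable under the complex-linear `f M = ad(e M) + c(M)·1` restricted to `𝔲(α, β)`, hence under every `f M` (the complex span of
`𝔲(α, β)` is `𝔤𝔩(α ⊕ β, ℂ)`, ★ `upq_isIrreducibleGK_of_forall_submodule`), hence under `ad(e M) = f M − c(M)·1` since `c(M) • w ∈ W`; so `W` is a Lie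
submodule, `⊥` or `⊤`.  §2 is the socket with `L = 𝔤𝔩(3, ℂ)`, `e` = reindexing along `Fin 2 ⊕ Fin 1 ≃ Fin 3` (★ `kovLie_apply`, ★ `lie_def`), `c = (e∕3)·tr`.
The socket's hypothesis `IsGKModule G21 ρK σ` is not needed for irreducibility (exactly as in ★ K0 and ★ `F0P3bKovacevicTransports.irredAdm_of_isGKModule`);
it is carried unused.  Two declarations:

* §1 `upq_isIrreducibleGK_of_lieModule_isIrreducible_addSmul` · ★ K0 with a scalar cocycle (generic, `α`, `β`, `L`, `c` arbitrary);
* §2 **`TwistIrreducible`**                                    · `sig_K2E1bTwistIrreducible` TOKEN FOR TOKEN (tie probe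
      `example : type_of% @TwistIrreducible = type_of% @K2E1bGKCohomologyU21.U0.sig_K2E1bTwistIrreducible := rfl`
      at home once the socket module ED. 2 is built on stream 29: `K2/K2E1b-p07/g0/Probe_K2E1bTwistIrreducible.lean`).

WHAT IS NOT HERE.  Existence of the twist (`sig_K2E1bKovLieTwist`, #3), the `K`-integration ∕ admissibility ∕ χ-scalars ∕ Hermitian form of the twist
(#4–#8) and the packaging #10 — other seats of the unit; Kovačević's irreducibility theorem itself (★ `SU21Irreducible`, an input here by hypothesis).

HONEST LABEL.  HC_CM is proved only modulo the 7 printed citations (2 remaining named inputs: hLiu418 = `stmt-HodgeConjecture-24832`, h413 =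
`stmt-HodgeConjecture-24833`) until rung 0 closes; this file moves no counter.

## References
* [Kovacevic2021] D. Kovačević, *Unitary `(𝔤, K)`-modules of `SU(2,1)`*, Acta Math. Spalatensia 1 (2021) — §3 Thm. 3 (irreducibility of the modules
  from `K`-types; the input `LieModule.IsIrreducible` of the socket).
* [BorelWallach2000] A. Borel, N. Wallach, *Continuous Cohomology, Discrete Subgroups, and Representations of Reductive Groups*, 2nd ed., AMS 2000 —
  0 §2.5 (irreducible admissible `(𝔤, K)`-modules).
* [KnappVogan1995] A. W. Knapp, D. A. Vogan, *Cohomological Induction and Unitary Representations* (1995) — §II.4 (after Cor. 2.78): irreducibility =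
  no invariant subspaces other than `0`, `V`; Prop. 4.120 (central characters).
* [Rogawski1990] J. Rogawski, *Automorphic Representations of Unitary Groups in Three Variables*, Ann. of Math. Stud. 123 (1990) — §12.3 pp. 176–178
  (the table the unit serves; context only).
-/

set_option autoImplicit false
-- the mandated namespace repeats the single-problem summit's segment (`HodgeConjecture.HodgeConjecture`)
set_option linter.dupNamespace false

noncomputable section

namespace Summit.HodgeConjecture.HodgeConjecture.Cruxes.H413.K2E1bTwistIrreducible

open Literature.NumberTheory.Automorphic
open Literature.RepresentationTheory.BorelWallach2000
open Literature.RepresentationTheory.KonnoKonno2007 Literature.RepresentationTheory.KonnoKonno2007.RealDualPair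
open Literature.RepresentationTheory.KonnoKonno2007.RealDualPair.UForm
open Literature.RepresentationTheory.Kovacevic2021 Literature.RepresentationTheory.Kovacevic2021.SU21Datum
open Summit.HodgeConjecture.HodgeConjecture.Cruxes.H413.F0P3bLocalAPacketsDefs
open Summit.HodgeConjecture.HodgeConjecture.Cruxes.H413.F0P3bU21Restriction
open Summit.HodgeConjecture.HodgeConjecture.Cruxes.H413.K2E1bGKCohomologyU21 (IsTwistOf)

-- Mathlib idiom (as in `GKModules`, the `Upq*` files, the Kovačević topic): commutator bracket on `Module.End` ∕ matrices
attribute [local instance 100] LieRing.ofAssociativeRing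

/-! ## §1 K0 with a central cocycle: irreducibility transport for `ρ𝔤 X v = ⁅e X, v⁆ + c(X) • v` -/

section Transport

variable {α β : Type*} [Fintype α] [DecidableEq α] [Fintype β] [DecidableEq β]
variable {V : Type*} [AddCommGroup V] [Module ℂ V]

/-- **Irreducibility transport from an irreducible complex Lie module, WITH A SCALAR COCYCLE** (★ K0
`upq_isIrreducibleGK_of_lieModule_isIrreducible` is the case `c = 0`): let `L` be a complex Lie algebra acting on `V` with `V` an irreducible
Lie module, `e : 𝔤𝔩(α ⊕ β, ℂ) →ₗ[ℂ] L` surjective, `c : 𝔤𝔩(α ⊕ β, ℂ) →ₗ[ℂ] ℂ` any complex-linear functional, and suppose the `𝔲(α, β)`-action is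
`ρ𝔤 X v = ⁅e X, v⁆ + c(X) • v`.  Then `(ρK, ρ𝔤)` is an irreducible `(𝔤, K)`-module for EVERY `K`-action `ρK`: a `(𝔤, K)`-submodule `W` is stable
under the complex-linear `f M = ad(e M) + c(M)·1`, hence (complex span, ★ K0) under every `f M`, hence under `ad(e M) = f M − c(M)·1`
(`c(M) • w ∈ W`), so `W` is a Lie submodule: `⊥` or `⊤`. [cite: KnappVogan1995, §II.4 (after Cor. 2.78)] -/
theorem upq_isIrreducibleGK_of_lieModule_isIrreducible_addSmul {L : Type*} [LieRing L] [LieAlgebra ℂ L]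
    [LieRingModule L V] [LieModule ℂ L V] [hV : LieModule.IsIrreducible ℂ L V]
    (e : Matrix (α ⊕ β) (α ⊕ β) ℂ →ₗ[ℂ] L) (he : Function.Surjective e) (c : Matrix (α ⊕ β) (α ⊕ β) ℂ →ₗ[ℂ] ℂ)
    (ρK : Representation ℂ (uFormGroup α β).maximalCompact V)
    (ρ𝔤 : (uFormGroup α β).lie →ₗ⁅ℝ⁆ Module.End ℂ V)
    (hρ : ∀ (X : (uFormGroup α β).lie) (v : V),
      ρ𝔤 X v = ⁅e (X : Matrix (α ⊕ β) (α ⊕ β) ℂ), v⁆ + c (X : Matrix (α ⊕ β) (α ⊕ β) ℂ) • v) :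
    IsIrreducibleGK ρK ρ𝔤 := by
  haveI : Nontrivial V := (LieSubmodule.nontrivial_iff ℂ L V).mp hV.toNontrivial
  -- the complex-linear action `M ↦ ad (e M) + c(M) • 1` restricting to `ρ𝔤`
  let f : Matrix (α ⊕ β) (α ⊕ β) ℂ →ₗ[ℂ] Module.End ℂ V :=
    (LieModule.toEnd ℂ L V : L →ₗ[ℂ] Module.End ℂ V) ∘ₗ e + c.smulRight (1 : Module.End ℂ V)
  have hfapply : ∀ (M : Matrix (α ⊕ β) (α ⊕ β) ℂ) (v : V), f M v = ⁅e M, v⁆ + c M • v := by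
    intro M v
    simp only [f, LinearMap.add_apply, LinearMap.coe_comp, Function.comp_apply, LinearMap.smulRight_apply,
      LinearMap.smul_apply, Module.End.one_apply, LieHom.coe_toLinearMap, LieModule.toEnd_apply_apply]
  have hf : ∀ X : (uFormGroup α β).lie, ρ𝔤 X = f (X : Matrix (α ⊕ β) (α ⊕ β) ℂ) := by
    intro X
    ext v
    rw [hρ, hfapply]
  refine upq_isIrreducibleGK_of_forall_submodule ρK ρ𝔤 f hf fun W hW => ?_
  -- `W` is stable under every `⁅l, ·⁆`, `l ∈ L` (`e` surjective, subtract the scalar part): it is a Lie submodule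
  have hlie : ∀ (l : L), ∀ w ∈ W, ⁅l, w⁆ ∈ W := by
    intro l w hw
    obtain ⟨M, rfl⟩ := he l
    have h1 : f M w - c M • w ∈ W := W.sub_mem (hW M w hw) (W.smul_mem (c M) hw)
    rwa [hfapply, add_sub_cancel_right] at h1
  let N : LieSubmodule ℂ L V := { W with lie_mem := fun {l} {w} hw => hlie l w hw }
  rcases hV.eq_bot_or_eq_top N with hN | hN
  · left
    exact (LieSubmodule.toSubmodule_eq_bot N).mpr hN
  · right
    exact (LieSubmodule.toSubmodule_eq_top N).mpr hN

end Transport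

/-! ## §2 The socket `sig_K2E1bTwistIrreducible`, token for token -/

/-- **Socket #9 `sig_K2E1bTwistIrreducible` of `Cruxes/H413/Lines/K2_E1b_GKCohomologyU21_U0_TwistIntegration.lean` (statement bytes frozen).**
IRREDUCIBILITY SURVIVES THE CENTRAL TWIST: for a Kovačević datum `𝒟` whose `𝔤𝔩(3, ℂ)`-module `𝒟.V` is irreducible and a twist `σ` of `𝒟.ρ` by
`e∕3` (`σ X = kovLie 𝒟.ρ X + (e∕3)·tr(X)·1`, `IsTwistOf`), the pair `(ρK, σ)` is an irreducible `(𝔲(2,1), K)`-module for every `K`-action `ρK`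
— §1 with `L = 𝔤𝔩(3, ℂ)`, `e` = the reindexing `Fin 2 ⊕ Fin 1 ≃ Fin 3` (surjective), `c = (e∕3)·tr`.  (The `IsGKModule` hypothesis of the socket is
not needed for irreducibility, exactly as in ★ K0 ∕ ★ `irredAdm_of_isGKModule`; it is carried unused.)
[cite: Kovacevic2021, §3 Thm. 3] [cite: BorelWallach2000, 0 §2.5] -/
theorem TwistIrreducible :
    ∀ (𝒟 : SU21Datum) (e : ℤ) (σ : G21.lie →ₗ⁅ℝ⁆ Module.End ℂ 𝒟.V), IsTwistOf 𝒟.ρ ((e : ℂ) / 3) σ →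
      LieModule.IsIrreducible ℂ (Matrix (Fin 3) (Fin 3) ℂ) 𝒟.V →
        ∀ ρK : Representation ℂ G21.maximalCompact 𝒟.V, IsGKModule G21 ρK σ → IsIrreducibleGK ρK σ := by
  intro 𝒟 e σ hσ hV ρK _
  haveI := hV
  refine upq_isIrreducibleGK_of_lieModule_isIrreducible_addSmul (L := Matrix (Fin 3) (Fin 3) ℂ)
    ((Matrix.reindexLinearEquiv ℂ ℂ (finSumFinEquiv : Fin 2 ⊕ Fin 1 ≃ Fin 3) (finSumFinEquiv : Fin 2 ⊕ Fin 1 ≃ Fin 3) :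
      Matrix (Fin 2 ⊕ Fin 1) (Fin 2 ⊕ Fin 1) ℂ ≃ₗ[ℂ] Matrix (Fin 3) (Fin 3) ℂ).toLinearMap)
    (LinearEquiv.surjective _) (((e : ℂ) / 3) • Matrix.traceLinearMap (Fin 2 ⊕ Fin 1) ℂ ℂ) ρK σ fun X v => ?_
  rw [hσ X, LinearMap.add_apply, LinearMap.smul_apply, Module.End.one_apply, kovLie_apply, lie_def, ρ_apply,
    LinearMap.smul_apply, Matrix.traceLinearMap_apply, smul_eq_mul]
  rfl

end Summit.HodgeConjecture.HodgeConjecture.Cruxes.H413.K2E1bTwistIrreducible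

end
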